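import Summits.BirchSwinnertonDyer.BirchSwinnertonDyer.Theorems.ByReductionTypeAtTwoRankOneAtTwoOffBigImageOddLocalEngineChebotarev
import Summits.BirchSwinnertonDyer.BirchSwinnertonDyer.Theorems.ByReductionTypeAtTwoRankOneAtTwoBigImageOddLocalOneDoorBottomCebotarev
import Summits.BirchSwinnertonDyer.BirchSwinnertonDyer.Theorems.ByReductionTypeAtTwoRankOneAtTwoBigImageOddLocalOneDoorBottomTranspositionCount
import Summits.BirchSwinnertonDyer.BirchSwinnertonDyer.Theorems.GenusKolyvaginAtTwoGenusPrimitiveSupplyAtTwoConjugationTypeAtTwo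
import Summits.BirchSwinnertonDyer.BirchSwinnertonDyer.Theorems.GenusKolyvaginAtTwoEquivariantChebotarevAtTwoIngredients
import Summits.BirchSwinnertonDyer.BirchSwinnertonDyer.Theorems.GenusKolyvaginAtTwoEquivariantKolyvaginExactAtTwoKolyvaginPrimeDictionary
import Literature.NumberTheory.EllipticCurves.TorsionLocalKernelRestrictionProofs
import Literature.NumberTheory.Automorphic.TunnellLemma
import HarnessLib

/-!
# Route ByReductionTypeAtTwo, crux `RankOneAtTwoBigImageOddLocal` (stmt-BirchSwinnertonDyer-23715), LINE v8.10 `one_door_analytic`: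
# U₀⁺ (`stub_firstDescentLeavesPos`, `Δ_W > 0`) — STEP B of McCallum's Cor. 3.2 at `M = 1` for a REGULAR element

Width prover seat `bsd-line-fkl-p2` g11 (2026-08-28), `--supports stmt-BirchSwinnertonDyer-23715` (helper).  THEOREMS ONLY (no
definition, no named fact, no `sorry`).  BSD is not proved by any of this.

At `Δ_W > 0` complex conjugation fixes `E[2]` pointwise (`ℚ(E[2])` is totally real), so Gross's Kolyvagin primes
(`Frob_ℓ = Frob_∞` on `K(E[2])`) see NO class of `H¹(ℚ, E[2])` at their place (local inflation defect `H¹(K_λ/ℚ_ℓ, E[2]) = E[2]`):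
the Čebotarev leaves `ceb₁` / `ceb₂` / `ceb₂'` of Kolyvagin's first `2`-descent over `ℚ` (`FirstDescentInput`, `…OneDoorFirstDescentDefs`)
must use REGULAR Kolyvagin primes (MEMO-es §18.11; card `regular-frobenius-kolyvagin-primes-pos-disc`): `ℓ` inert in `K` whose Frobenius
acts on `E[2]` as a TRANSPOSITION `t₀` — equivalently `(Δ_min/ℓ) = −1` — so that `a_ℓ` is even (`M(ℓ) ≥ 1`), `Frob_λ = Frob_ℓ² = 1` on
`E[2]`, `H¹(K_λ/ℚ_ℓ, E[2]) = ker(1+t₀)/im(1+t₀) = 0`, and `#E(ℚ_ℓ)[2] = 2`.  The 23716 lead LANDED Steps C–H of McCallum's Cor. 3.2 for such a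
regular element (`OffBigImageOddLocalAtTwo.Engine.exists_kolyvaginPrime_gt_two_of_galoisElement_regular`); THIS FILE supplies its Step B
at `M = 1`, for families of PAIRS `(u_i, v_i) ∈ H¹(ℚ, E[2]) × H¹(ℚ, E^{(d)}[2])` descended to `c_i = res u_i + hPsiKT (res v_i) ∈ H¹(K, E_K[2])`
(the currency of route GenusKolyvaginAtTwo's visible Čebotarev), so that the E-side pair AND the cross pair of the record are covered:

* §1 `h1Eval_mul_smul` (the chosen cocycle is a crossed homomorphism on ALL of `Γ`), `swapAut_swapAut`, `swapAut_T_zero_ne`,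
  `add_eq_zero_iff_eq_two`;
* §2 transport along `E^{(d)}_K ≅ E_K`: `mem_torsionFixing_twist_of_mem`, `h1Eval_hPsiKT` (`[hPsiKT z, τ] = psiKT [z, τ]`),
  `torsionBaseChangeMap_psiQT`, `psiQT_smul_absGaloisRestrict`;
* §3 `h1Eval_resTorsion_conj_mul` (`[res x, g^τ g] = θ(Φ(h) + h·Φ(h))`, `h = c₀ · res g`, from `res (g^τ g) = h²`),
  `conj_mul_mem_torsionFixing_of_sq`, and **`exists_regular_galoisElement_two`**: there is `ρ ∈ Γ_K` with `c₀ · res ρ` acting on `E[2]` as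
  the transposition `swapAut` such that for every `m` in the joint evaluation kernel `𝒩` and every `i`, `[c_i, (ρm)^τ (ρm)] = θ(T₀ + T₁) ≠ 0`
  — via `A_i := [u_i, ·] + ψ ∘ [v_i, ·]` (`ψ = psiQT`) and the joint surjectivity of the evaluations (gk2's `exists_h1Eval_eq_of_indep_of_res`:
  `E_K[2]` simple with scalar commutant, no inflation defect over `K` at level `2` — `image_two_of_not_isSquare`, `hinjK_of_not_isSquare`).

The sibling `…OneDoorBottomPosCebotarev.lean` feeds this to Steps C–H and reads the primes back over `ℚ` (`(Δ_min/ℓ) = −1`, Zhang's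
predicate, non-vanishing at `v ∋ ℓ`) in the three shapes `ceb₁` / `ceb₂` / `ceb₂'` of the record.

References: [McCallumLMS1991] §3 (2), Prop. 3.1, Cor. 3.2; [GrossLMS1991] §9 Props. 9.1, 9.3; [Kolyvagin1989Izv] §3 (the pair `(E, E^D)`);
[SerreGaloisCohomology1997] I.§2.4.
-/

set_option autoImplicit false
-- the Theorems namespace of this sub repeats the summit name by design (D-0017 nested layout)
set_option linter.dupNamespace false

noncomputable section

open scoped Classical

namespace Summit.BirchSwinnertonDyer.BirchSwinnertonDyer.Theorems.RankOneAtTwoOneDoor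

open WeierstrassCurve NumberField IsDedekindDomain Field Finset
open Literature.NumberTheory.EllipticCurves Literature.NumberTheory.GaloisRepresentations Literature.NumberTheory
open Literature.NumberTheory.EllipticCurves.DokchitserDokchitser2012
open Summit.BirchSwinnertonDyer.BirchSwinnertonDyer.Theorems.GenusExact
open Summit.BirchSwinnertonDyer.BirchSwinnertonDyer.Theorems.GenusExact.EigenClassesFinite
open Summit.BirchSwinnertonDyer.BirchSwinnertonDyer.Theorems.GenusExact.SelmerDescent

/-! ## §1 Cocycle bookkeeping -/

section Cocycle

variable {F : Type} [Field F] (X : WeierstrassCurve F) (n : ℤ)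

/-- The chosen cocycle of `x` is a crossed homomorphism: `[x, ab] = [x, a] + a • [x, b]` for ALL `a, b ∈ Γ`
(`h1Eval` is the value of `reprCocycle`). [cite: SerreGaloisCohomology1997, I.§2.2] -/
theorem h1Eval_mul_smul (x : galH1Torsion X n) (a b : absoluteGaloisGroup F) :
    h1Eval X n x (a * b) = h1Eval X n x a + a • h1Eval X n x b := by
  have h := (reprCocycle X n x).2 a b
  rw [discreteTopRep_ρ_apply] at h
  exact h

end Cocycle

section TwoTorsion

variable {F : Type} [Field F] (X : WeierstrassCurve F) [X.IsElliptic] (h2 : (2 : F) ≠ 0)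

/-- `swapAut` is an involution of `E[2]`. [folklore] -/
theorem swapAut_swapAut (P : geomTorsion X 2) : swapAut X h2 (swapAut X h2 P) = P := by
  rcases eq_zero_or_eq_T X h2 P with rfl | ⟨i, rfl⟩
  · rw [map_zero, map_zero]
  · rw [← T_perm X h2, ← T_perm X h2, perm_swapAut, Equiv.swap_apply_self]

/-- `swapAut` moves `T₀` (to `T₁`). [folklore] -/
theorem swapAut_T_zero_ne : swapAut X h2 (T X h2 0) ≠ T X h2 0 := by
  rw [← T_perm X h2, perm_swapAut, Equiv.swap_apply_left]
  exact fun h => absurd (T_injective X h2 h) (by decide)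

omit [X.IsElliptic] in
/-- In `E[2]`, `P + Q = 0 ↔ P = Q` (every element is its own negative). [folklore] -/
theorem add_eq_zero_iff_eq_two (P Q : geomTorsion X 2) : P + Q = 0 ↔ P = Q := by
  have hQ : Q + Q = 0 := Subtype.ext (coe_add_self_eq_zero X Q)
  constructor
  · intro h
    have : P + Q = Q + Q := by rw [h, hQ]
    exact add_right_cancel this
  · rintro rfl; exact hQ

end TwoTorsion

/-! ## §2 Transport lemmas for the twist `E^{(d)}_K ≅ E_K` (`psiKT`, `hPsiKT`, `psiQT`) -/

section Twist

variable (W : WeierstrassCurve ℚ) (K : Type) [Field K] [NumberField K]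
  {θ : K} (hθ : θ ∉ Set.range (algebraMap ℚ K)) {d : ℚ} (hcθ : θ ^ 2 = algebraMap ℚ K d) (n : ℤ)

include hθ hcθ in
/-- `Γ_{K(E_K[n])}` fixes `E^{(d)}_K[n]` too (`psiKT` is a `Γ_K`-equivariant bijection). [cite: SilvermanAEC2009, X.5 Cor. 5.4] -/
theorem mem_torsionFixing_twist_of_mem {τ : absoluteGaloisGroup K} (hτ : τ ∈ torsionFixing (W.baseChange K) n) :
    τ ∈ torsionFixing ((W.quadraticTwist d).baseChange K) n :=
  (mem_torsionFixing_iff _ _).mpr fun P => (psiKT W K hθ hcθ n).injective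
    (by rw [psiKT_smul, smul_eq_of_mem_torsionFixing _ n hτ])

/-- **`[hPsiKT z, τ] = psiKT [z, τ]`** for `τ ∈ Γ_{K(E_K[n])}`: `hPsiKT` is the map of the compatible pair `(id, psiKT)`, so the
chosen cocycle of `hPsiKT z` and `psiKT ∘ (chosen cocycle of z)` both represent `hPsiKT z` and agree on `Γ_{K(E_K[n])}`.
[cite: SerreGaloisCohomology1997, I.§2.4 (compatible pairs)] -/
theorem h1Eval_hPsiKT (z : galH1Torsion ((W.quadraticTwist d).baseChange K) n) {τ : absoluteGaloisGroup K}
    (hτ : τ ∈ torsionFixing (W.baseChange K) n) :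
    h1Eval (W.baseChange K) n (hPsiKT W K hθ hcθ n z) τ =
      psiKT W K hθ hcθ n (h1Eval ((W.quadraticTwist d).baseChange K) n z τ) := by
  have hclass : hPsiKT W K hθ hcθ n z = oneCocycleClass _
      (contOneCocycles.pullback (ContinuousMonoidHom.id _)
        (resHomOfEquivariant (ContinuousMonoidHom.id _) (psiKT W K hθ hcθ n).toAddMonoidHom (psiKT_smul W K hθ hcθ n))
        (reprCocycle ((W.quadraticTwist d).baseChange K) n z)) := by
    conv_lhs => rw [← oneCocycleClass_reprCocycle ((W.quadraticTwist d).baseChange K) n z]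
    rw [hPsiKT_apply, resH1Hom_oneCocycleClass]
  rw [hclass, h1Eval_oneCocycleClass _ _ _ hτ, pullback_resHomOfEquivariant_apply]
  rfl

/-- **`θ_E ∘ ψ = psiKT ∘ θ_{E^{(d)}}`** on `E^{(d)}[n](ℚ̄)` (`ψ = psiQT` is `psiKT` read through the coefficient maps `θ`). [cite: SilvermanAEC2009, X.5 Cor. 5.4] -/
theorem torsionBaseChangeMap_psiQT (P : geomTorsion (W.quadraticTwist d) n) :
    torsionBaseChangeMap W K n (psiQT W K hθ hcθ n P) =
      psiKT W K hθ hcθ n (torsionBaseChangeMap (W.quadraticTwist d) K n P) := by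
  haveI : Algebra.IsAlgebraic ℚ K := Algebra.IsAlgebraic.of_finite ℚ K
  rw [psiQT_apply, ← torsionBaseChangeEquiv_apply, AddEquiv.apply_symm_apply, torsionBaseChangeEquiv_apply]

/-- **`ψ` is equivariant along the embedded `Γ_K`**: `ψ (res g • P) = res g • ψ P` (`psiQT_smul` at `resGalToRange g`). [cite: SerreGaloisCohomology1997, I.§2.4] -/
theorem psiQT_smul_absGaloisRestrict (g : absoluteGaloisGroup K) (P : geomTorsion (W.quadraticTwist d) n) :
    psiQT W K hθ hcθ n (absGaloisRestrict ℚ K g • P) = absGaloisRestrict ℚ K g • psiQT W K hθ hcθ n P := by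
  haveI : Algebra.IsAlgebraic ℚ K := Algebra.IsAlgebraic.of_finite ℚ K
  have h := psiQT_smul W K hθ hcθ n (resGalToRange (K := ℚ) K g) P
  rwa [Subgroup.smul_def, Subgroup.smul_def, coe_resGalToRange, resGal_eq_absGaloisRestrict] at h

end Twist

/-! ## §3 Step B at `M = 1` for a REGULAR element, for families of PAIRS `(u_i, v_i) ∈ H¹(ℚ, E[2]) × H¹(ℚ, E^{(d)}[2])` -/

section Frobenius

variable (K : Type) [Field K] [NumberField K] (X : WeierstrassCurve ℚ)

/-- **The value of a restricted class at McCallum's Frobenius `g^τ g`.**  For `x ∈ H¹(ℚ, X[n])` (`X/ℚ` any curve), `g ∈ Γ_K`, the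
involutive lift `τ` of the complex conjugation of `K` built from `c₀`, and `h := c₀ · res g ∈ Γ_ℚ`: whenever `g^τ g` fixes `X_K[n]`,
`[res x, g^τ g] = θ (Φ(h) + h·Φ(h))`, where `Φ = [x, ·]` is the chosen cocycle of `x` on `Γ_ℚ` and `θ : X[n](ℚ̄) → X_K[n](K̄)` the
coefficient map (`res (g^τ g) = h²` and the cocycle identity). [cite: McCallumLMS1991, §3 Prop. 3.1 (proof)] -/
theorem h1Eval_resTorsion_conj_mul (hK : IsImaginaryQuadratic K)
    {c₀ : absoluteGaloisGroup ℚ} (hc₀ : IsComplexConjugation (Rat.castHom ℝ) c₀) {c : K ≃ₐ[ℚ] K} (hc : c ≠ 1)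
    (n : ℤ) (x : galH1Torsion X n) (g : absoluteGaloisGroup K)
    (hfix : (RatClosure.isLiftOfAut_absGaloisTransport_of_isImaginaryQuadratic hK hc hc₀).conjGalCMH g * g ∈
      torsionFixing (X.baseChange K) n) :
    h1Eval (X.baseChange K) n (resTorsion X K n x)
        ((RatClosure.isLiftOfAut_absGaloisTransport_of_isImaginaryQuadratic hK hc hc₀).conjGalCMH g * g) =
      torsionBaseChangeMap X K n
        (h1Eval X n x (c₀ * absGaloisRestrict ℚ K g) +
          (c₀ * absGaloisRestrict ℚ K g) • h1Eval X n x (c₀ * absGaloisRestrict ℚ K g)) := by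
  rw [h1Eval_resTorsion_eq X K n x hfix, resGal_eq_absGaloisRestrict,
    ← sq_eq_absGaloisRestrict_conjGal_mul hc₀ _ g, pow_two, h1Eval_mul_smul]

/-- **`g^τ g` fixes `X_K[n]` when `c₀ · res g` is an involution on `X[n]`** (`res (g^τ g) = (c₀ · res g)²`, transport
`X[n](ℚ̄) ≃ X_K[n](K̄)`). [cite: McCallumLMS1991, §3 Prop. 3.1 (proof)] -/
theorem conj_mul_mem_torsionFixing_of_sq (hK : IsImaginaryQuadratic K)
    {c₀ : absoluteGaloisGroup ℚ} (hc₀ : IsComplexConjugation (Rat.castHom ℝ) c₀) {c : K ≃ₐ[ℚ] K} (hc : c ≠ 1)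
    (n : ℤ) (g : absoluteGaloisGroup K)
    (hsq : ∀ P : geomTorsion X n, (c₀ * absGaloisRestrict ℚ K g) • (c₀ * absGaloisRestrict ℚ K g) • P = P) :
    (RatClosure.isLiftOfAut_absGaloisTransport_of_isImaginaryQuadratic hK hc hc₀).conjGalCMH g * g ∈
      torsionFixing (X.baseChange K) n := by
  haveI : Algebra.IsAlgebraic ℚ K := Algebra.IsAlgebraic.of_finite ℚ K
  refine (mem_torsionFixing_iff _ _).mpr fun Q => ?_
  obtain ⟨P, rfl⟩ := (RatClosure.torsionEquiv (K := K) X n).surjective Q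
  rw [← RatClosure.torsionEquiv_smul, ← sq_eq_absGaloisRestrict_conjGal_mul hc₀ _ g, pow_two, mul_smul, hsq]

end Frobenius

section StepB

variable (W : WeierstrassCurve ℚ) [W.IsElliptic] (K : Type) [Field K] [NumberField K]

/-- **Step B of McCallum's Cor. 3.2 at `p = 2`, `M = 1`, for a REGULAR element and a family of PAIRS.**  Data: `W/ℚ` elliptic with
`Δ_W > 0` and `ρ̄_{W,2}` onto; `K = ℚ(θ)` imaginary quadratic, `θ² = d`, with `d_K · Δ_W ∉ ℚ^{×2}`, `E^{(d)}` elliptic with `Δ > 0`; a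
complex conjugation `c₀` and the non-trivial `c ∈ Aut(K/ℚ)`; pairs `(u_i, v_i) ∈ H¹(ℚ, W[2]) × H¹(ℚ, W^{(d)}[2])` whose descended classes
`c_i := res u_i + hPsiKT (res v_i) ∈ H¹(K, E_K[2])` are `𝔽₂`-independent.  THEN there is `ρ ∈ Γ_K` such that `h₀ := c₀ · res ρ` acts on
`E[2]` as the transposition `swapAut` (`T₀ ↔ T₁`), and for every `m` in the joint kernel `𝒩` of the evaluations of the `c_i` on `Γ_{K(E[2])}`
and every `i`, `[c_i, (ρm)^τ (ρm)] ≠ 0` — indeed `= θ(T₀ + T₁)`.  Proof: with `A_i := [u_i, ·] + ψ ∘ [v_i, ·] : Γ_ℚ → E[2]` (`ψ = psiQT`,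
equivariant along `c₀ · res Γ_K` since complex conjugation fixes `E[2]` and `E^{(d)}[2]`), `[c_i, g^τ g] = θ(A_i(h) + h·A_i(h))` for
`h = c₀ res g`; take `ρ = ρ₁ n` with `c₀ · res ρ₁` a transposition (from `ρ̄_{W,2}` onto, `[Γ_ℚ : res Γ_K] = 2`, `c₀ ∉ res Γ_K`) and
`n ∈ Γ_{K(E[2])}` realising `[c_i, n] = θ(t₀(T₀ − A_i(c₀ res ρ₁)))` (joint surjectivity `exists_h1Eval_eq_of_indep_of_res`: `E_K[2]` simple
with scalar commutant, no inflation defect over `K` at level `2`); then `A_i(h₀) = T₀` for `h₀ = c₀ res(ρ₁ n m)` and the value is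
`θ(T₀ + T₁) ≠ 0`. [cite: McCallumLMS1991, §3 Prop. 3.1, Cor. 3.2] [cite: GrossLMS1991, §9 Props. 9.1, 9.3] [cite: Kolyvagin1989Izv, §3] -/
theorem exists_regular_galoisElement_two (hΔ : 0 < W.Δ) (hK : IsImaginaryQuadratic K)
    (hns : ¬ IsSquare ((NumberField.discr K : ℚ) * W.Δ)) (hsurj : W.HasSurjectiveModNGaloisRep 2)
    {θ : K} (hθ : θ ∉ Set.range (algebraMap ℚ K)) {d : ℚ} (hcθ : θ ^ 2 = algebraMap ℚ K d)
    [(W.quadraticTwist d).IsElliptic] (hΔ' : 0 < (W.quadraticTwist d).Δ)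
    {c₀ : absoluteGaloisGroup ℚ} (hc₀ : IsComplexConjugation (Rat.castHom ℝ) c₀) {c : K ≃ₐ[ℚ] K} (hc : c ≠ 1)
    {r : ℕ} (us : Fin r → galH1Torsion W 2) (vs : Fin r → galH1Torsion (W.quadraticTwist d) 2)
    (hind : ∀ a : Fin r → ℤ,
      ∑ i, a i • (resTorsion W K 2 (us i) + hPsiKT W K hθ hcθ 2 (resTorsion (W.quadraticTwist d) K 2 (vs i))) = 0 →
        ∀ i, (2 : ℤ) ∣ a i) :
    ∃ ρ : absoluteGaloisGroup K,
      (∀ P : geomTorsion W 2, (c₀ * absGaloisRestrict ℚ K ρ) • P = swapAut W two_ne_zero P) ∧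
      ∀ m ∈ evalKer (W.baseChange K) 2
          (fun i => resTorsion W K 2 (us i) + hPsiKT W K hθ hcθ 2 (resTorsion (W.quadraticTwist d) K 2 (vs i))), ∀ i,
        h1Eval (W.baseChange K) 2 (resTorsion W K 2 (us i) + hPsiKT W K hθ hcθ 2 (resTorsion (W.quadraticTwist d) K 2 (vs i)))
          ((RatClosure.isLiftOfAut_absGaloisTransport_of_isImaginaryQuadratic hK hc hc₀).conjGalCMH (ρ * m) * (ρ * m)) ≠ 0 := by
  haveI : Algebra.IsAlgebraic ℚ K := Algebra.IsAlgebraic.of_finite ℚ K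
  haveI : IsTotallyComplex K := hK.2
  have h2K : Module.finrank ℚ K = 2 := hK.1
  set sw := swapAut W (two_ne_zero : (2 : ℚ) ≠ 0) with hsw
  set cs : Fin r → galH1Torsion (W.baseChange K) 2 :=
    fun i => resTorsion W K 2 (us i) + hPsiKT W K hθ hcθ 2 (resTorsion (W.quadraticTwist d) K 2 (vs i)) with hcs
  -- ### (0) `ψ` is equivariant along `c₀ · res Γ_K`; the functions `A_i = [u_i, ·] + ψ ∘ [v_i, ·] : Γ_ℚ → E[2]`
  have hψg : ∀ (g : absoluteGaloisGroup K) (P : geomTorsion (W.quadraticTwist d) 2),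
      psiQT W K hθ hcθ 2 ((c₀ * absGaloisRestrict ℚ K g) • P) = (c₀ * absGaloisRestrict ℚ K g) • psiQT W K hθ hcθ 2 P := fun g P => by
    rw [mul_smul, mul_smul, GenusKolySign.twoTorsion_smul_eq_of_Δ_pos (W.quadraticTwist d) hΔ' hc₀, psiQT_smul_absGaloisRestrict,
      GenusKolySign.twoTorsion_smul_eq_of_Δ_pos W hΔ hc₀]
  set A : Fin r → absoluteGaloisGroup ℚ → geomTorsion W 2 :=
    fun i a => h1Eval W 2 (us i) a + psiQT W K hθ hcθ 2 (h1Eval (W.quadraticTwist d) 2 (vs i) a) with hA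
  have hAmul : ∀ i (x g : absoluteGaloisGroup K),
      A i (c₀ * absGaloisRestrict ℚ K x * absGaloisRestrict ℚ K g) =
        A i (c₀ * absGaloisRestrict ℚ K x) + (c₀ * absGaloisRestrict ℚ K x) • A i (absGaloisRestrict ℚ K g) := by
    intro i x g
    simp only [hA, h1Eval_mul_smul, map_add, smul_add, hψg]
    abel
  -- `[c_i, τ] = θ (A_i (res τ))` on `Γ_{K(E[2])}`
  have hAeval : ∀ i {τ : absoluteGaloisGroup K}, τ ∈ torsionFixing (W.baseChange K) 2 →
      h1Eval (W.baseChange K) 2 (cs i) τ = torsionBaseChangeMap W K 2 (A i (absGaloisRestrict ℚ K τ)) := by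
    intro i τ hτ
    have hτ' : τ ∈ torsionFixing ((W.quadraticTwist d).baseChange K) 2 := mem_torsionFixing_twist_of_mem W K hθ hcθ 2 hτ
    rw [hcs, h1Eval_add _ _ _ _ hτ, h1Eval_resTorsion_eq W K 2 (us i) hτ, h1Eval_hPsiKT W K hθ hcθ 2 _ hτ,
      h1Eval_resTorsion_eq (W.quadraticTwist d) K 2 (vs i) hτ', resGal_eq_absGaloisRestrict, ← torsionBaseChangeMap_psiQT W K hθ hcθ 2, ← map_add]
  -- ### (1) a regular element `g₁ = c₀ · res ρ₁` acting on `E[2]` as the transposition `swapAut`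
  obtain ⟨γ, hγ⟩ := hsurj (Multiplicative.ofAdd sw)
  have hγP : ∀ P : geomTorsion W 2, γ • P = sw P := fun P => by
    rw [← galoisRepTorsion_apply W 2 γ P, hγ, toAdd_ofAdd]
  have hc₀H : c₀ ∉ Set.range (absGaloisRestrict ℚ K) :=
    hc₀.not_mem_range_absGaloisRestrict (L := K) IsTotallyComplex.isComplex
  obtain ⟨ρ₁, hρ₁⟩ : ∃ ρ₁ : absoluteGaloisGroup K,
      ∀ P : geomTorsion W 2, (c₀ * absGaloisRestrict ℚ K ρ₁) • P = sw P := by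
    by_cases hγH : γ ∈ Set.range (absGaloisRestrict ℚ K)
    · obtain ⟨ρ₁, rfl⟩ := hγH
      exact ⟨ρ₁, fun P => by rw [mul_smul, hγP, GenusKolySign.twoTorsion_smul_eq_of_Δ_pos W hΔ hc₀]⟩
    · obtain ⟨ρ₁, hρ₁⟩ := inv_mul_mem_range_absGaloisRestrict h2K hc₀H hγH
      exact ⟨ρ₁, fun P => by rw [hρ₁, mul_inv_cancel_left, hγP]⟩
  -- ### (2) the descended family over `K`: `2`-torsion, independent, visible
  obtain ⟨hS, hC⟩ := image_two_of_not_isSquare W K h2K hsurj hns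
  have hinjK := hinjK_of_not_isSquare W K h2K hsurj hns
  have he : ∀ i, ((2 : ℕ) : ℤ) ^ (fun _ : Fin r => 1) i • cs i = 0 := fun i => by
    rw [pow_one]; exact_mod_cast zsmul_galH1Torsion_eq_zero (W.baseChange K) 2 (cs i)
  have hind' : ∀ a : Fin r → ℤ, ∑ i, a i • cs i = 0 → ∀ i, ((2 : ℕ) : ℤ) ^ (fun _ : Fin r => 1) i ∣ a i := by
    intro a ha i
    rw [pow_one]
    exact hind a ha i
  have hres' : ∀ a : Fin r → ℤ, (∀ ρ ∈ torsionFixing (W.baseChange K) 2, h1Eval (W.baseChange K) 2 (∑ i, a i • cs i) ρ = 0) →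
      ∑ i, a i • cs i = 0 := fun a ha => hinjK _ ha
  -- ### (3) the targets `θ (sw (T₀ − A_i(g₁)))`, realised by `n ∈ Γ_{K(E[2])}`
  set u : geomTorsion W 2 := T W (two_ne_zero : (2 : ℚ) ≠ 0) 0 with hu
  set a : Fin r → geomTorsion W 2 := fun i => A i (c₀ * absGaloisRestrict ℚ K ρ₁) with ha
  set t : Fin r → geomTorsion (W.baseChange K) 2 := fun i => torsionBaseChangeMap W K 2 (sw (u - a i)) with htdef
  have ht : ∀ i, ((2 : ℕ) : ℤ) ^ (fun _ : Fin r => 1) i • t i = 0 := fun i => by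
    rw [pow_one]
    apply Subtype.ext
    exact_mod_cast (mem_geomTorsion_iff _ _ _).mp (t i).2
  obtain ⟨n, hn, hnt⟩ := exists_h1Eval_eq_of_indep_of_res (W.baseChange K) Nat.prime_two (n := 2) (dvd_refl _) hS hC
    cs (fun _ => 1) he hind' hres' t ht
  -- ### (4) `ρ = ρ₁ n`
  refine ⟨ρ₁ * n, fun P => ?_, fun m hm i => ?_⟩
  · rw [map_mul, ← mul_assoc, mul_smul (c₀ * _), absGaloisRestrict_smul_eq_of_mem_torsionFixing W hn, hρ₁]
  · have hmT : m ∈ torsionFixing (W.baseChange K) 2 := hm.1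
    -- `h = c₀ · res(ρ₁ n m)` acts on `E[2]` as `sw`
    have hact : ∀ P : geomTorsion W 2, (c₀ * absGaloisRestrict ℚ K (ρ₁ * n * m)) • P = sw P := fun P => by
      rw [map_mul, map_mul, ← mul_assoc, ← mul_assoc, mul_smul (c₀ * _ * _), mul_smul (c₀ * _),
        absGaloisRestrict_smul_eq_of_mem_torsionFixing W hmT, absGaloisRestrict_smul_eq_of_mem_torsionFixing W hn, hρ₁]
    have hsq : ∀ P : geomTorsion W 2, (c₀ * absGaloisRestrict ℚ K (ρ₁ * n * m)) •
        (c₀ * absGaloisRestrict ℚ K (ρ₁ * n * m)) • P = P := fun P => by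
      rw [hact, hact, hsw, swapAut_swapAut]
    have hfix := conj_mul_mem_torsionFixing_of_sq K W hK hc₀ hc 2 (ρ₁ * n * m) hsq
    have hfix' : (RatClosure.isLiftOfAut_absGaloisTransport_of_isImaginaryQuadratic hK hc hc₀).conjGalCMH (ρ₁ * n * m) *
        (ρ₁ * n * m) ∈ torsionFixing ((W.quadraticTwist d).baseChange K) 2 := mem_torsionFixing_twist_of_mem W K hθ hcθ 2 hfix
    -- `A_i(res m) = 0`, `A_i(res n) = sw (T₀ − a_i)`, `A_i(h) = T₀`
    have hAm : A i (absGaloisRestrict ℚ K m) = 0 := by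
      have h := hAeval i hmT
      have h0 : h1Eval (W.baseChange K) 2 (cs i) m = 0 := hm.2 i
      rw [h0] at h
      exact ((map_eq_zero_iff _ (torsionBaseChangeMap_injective W K 2)).mp h.symm)
    have hAn : A i (absGaloisRestrict ℚ K n) = sw (u - a i) := by
      have h := hAeval i hn
      have h1 : h1Eval (W.baseChange K) 2 (cs i) n = t i := hnt i
      rw [h1, htdef] at h
      exact (torsionBaseChangeMap_injective W K 2 h).symm
    have hAh : A i (c₀ * absGaloisRestrict ℚ K (ρ₁ * n * m)) = u := by
      rw [map_mul, ← mul_assoc, hAmul, hAm, smul_zero, add_zero, map_mul, ← mul_assoc, hAmul, hAn, hρ₁, hsw, swapAut_swapAut]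
      simp only [ha, add_sub_cancel]
    -- the value `θ (A_i(h) + h • A_i(h)) = θ (T₀ + T₁) ≠ 0`
    have hval : h1Eval (W.baseChange K) 2 (cs i)
        ((RatClosure.isLiftOfAut_absGaloisTransport_of_isImaginaryQuadratic hK hc hc₀).conjGalCMH (ρ₁ * n * m) * (ρ₁ * n * m)) =
        torsionBaseChangeMap W K 2 (A i (c₀ * absGaloisRestrict ℚ K (ρ₁ * n * m)) +
          (c₀ * absGaloisRestrict ℚ K (ρ₁ * n * m)) • A i (c₀ * absGaloisRestrict ℚ K (ρ₁ * n * m))) := by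
      rw [hcs, h1Eval_add _ _ _ _ hfix, h1Eval_resTorsion_conj_mul K W hK hc₀ hc 2 (us i) _ hfix, h1Eval_hPsiKT W K hθ hcθ 2 _ hfix,
        h1Eval_resTorsion_conj_mul K (W.quadraticTwist d) hK hc₀ hc 2 (vs i) _ hfix', ← torsionBaseChangeMap_psiQT W K hθ hcθ 2, ← map_add]
      simp only [hA, map_add, hψg, smul_add]
      abel
    rw [hval, hAh, hact, map_ne_zero_iff _ (torsionBaseChangeMap_injective W K 2), Ne, add_eq_zero_iff_eq_two]
    exact (swapAut_T_zero_ne W two_ne_zero).symm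

end StepB

end Summit.BirchSwinnertonDyer.BirchSwinnertonDyer.Theorems.RankOneAtTwoOneDoor

end
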